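import Summits.AtomisticToContinuum.FouriersLaw.Theorems.LocalOhmBVLocalOhmShiftAverage
import Literature.MathematicalPhysics.KineticTheory.InfiniteChainPartialMomentumReversal
import Literature.MathematicalPhysics.KineticTheory.InfiniteChainCovarianceMixingBox
import Literature.MathematicalPhysics.KineticTheory.InfiniteChainObservables

/-!
# The harmonic conserved-current functional (Aux 1: the static current functional for `lam, β ≥ 0`)

Crux item stmt-AtomisticToContinuum-12009 (`Summit.AtomisticToContinuum.FouriersLaw.Theses.LocalOhmBV.LocalOhm`, shared with
`…TransferKernelPositivity.LocalOhm`), line `registered` (birth), lead c5, cycle 2 (2026-08-17): kernel-checked CALIBRATION of the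
open rigidity stub VZD `stub_zeroDrudeVar` (variational zero current Drude weight) and of its predecessor S3
`stub_oddSectorLiouvilleSym` (odd-sector Liouville rigidity): both FAIL for the pinned HARMONIC chain `pinnedChain ω₂ 0 0 γ`, so every
proof of either must use the anharmonicity `lam, β > 0` — the formal content of the route header's "false at lam = β = 0".

The witness is the static current functional `T_μ(f) = Σ_z ∫ f · j_z dμ` (a finite sum for cylinder `f`: currents on bonds off the
window are orthogonal to window observables), normalised by `c = ∫ j_0² + 2 ∫ j_0 j_1 > 0`:

* for EVERY `lam, β ≥ 0` the functional `Λ = T_μ / c` over the shift-invariant Gibbs state is shift invariant, odd under momentum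
  reversal, linear on cylinder pairs, `√n`-REGULAR (`|T_μ(g ∘ box_{a,n})| ≤ √(6 ∫ j_0²) √(n+1) ‖g ∘ box_{a,n}‖_{L²(μ)}`: the currents
  `j_z`, `j_w` are orthogonal for `|z - w| ≥ 2`) and has unit current on every bond (`T_μ(j_i) = c`);
* at the HARMONIC corner it is moreover `liouvilleZ`-INVARIANT: `Σ_z ∫ 𝒜(G ∘ box) j_z dμ = 0`, because the harmonic energy current
  is conserved (`𝒜 j_z = ½(u_z - u_{z+1})`, `harmonic_sum_integral_liouvilleZ_mul_bondCurrentZ`) and the boundary covariances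
  `Cov(G ∘ box, u_{z₁})`, `Cov(G ∘ box, u_{z₂+1})` vanish in the limit (`gibbs_window_cov_tendsto_zero`).

THIS FILE (Aux 1) is pure measure theory on `ChainConfig`, for ANY chain `P`, ANY DLR state `μ` (shift invariant where said) and
square-integrability taken as hypotheses: finite support, shift invariance, oddness, linearity, unit current and `√n`-regularity of
`T_μ`; the harmonic invariance, the witness and the two refutations are in `…HarmonicCounterexample.lean` (which supplies the `L²`
facts for the pinned chain). Folklore throughout; no definitions, no named facts.
-/

set_option autoImplicit false

noncomputable section

namespace Summit.AtomisticToContinuum.FouriersLaw.Theorems.LocalOhmBirth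

open MeasureTheory Filter Topology
open scoped BigOperators
open Literature.MathematicalPhysics.KineticTheory
open Literature.MathematicalPhysics.KineticTheory.HeatConduction

/-! ## Statics (any chain, any DLR state): currents off the window, finite support of `z ↦ ∫ f j_z` -/

/-- **Finite support.** For a window observable `g ∘ box_{a,n}` and every finite set of bonds `S ⊇ {a-1, …, a+n}`:
`Σ'_z ∫ g(box) j_z dμ = Σ_{z ∈ S} ∫ g(box) j_z dμ` (every DLR state of every chain). [folklore] -/
theorem tsum_integral_window_mul_bondCurrentZ_eq_sum {P : OscillatorChain} {T : ℝ}
    {μ : Measure ChainConfig} (hμ : P.IsChainGibbsMeasure T μ) (a : ℤ) (n : ℕ)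
    (g : (Fin (n + 1) → ℝ × ℝ) → ℝ) {S : Finset ℤ} (hS : ∀ z : ℤ, a - 1 ≤ z → z ≤ a + n → z ∈ S) :
    ∑' z : ℤ, ∫ σ, g (boxRestrictAt a n σ) * P.bondCurrentZ σ z ∂μ =
      ∑ z ∈ S, ∫ σ, g (boxRestrictAt a n σ) * P.bondCurrentZ σ z ∂μ := by
  refine tsum_eq_sum fun z hz => ?_
  -- the bond `{z, z+1}` is off the box: the integrand is odd under the reversal of the momenta at `{z, z+1}`
  have hoff : z + 1 < a ∨ a + (n : ℤ) < z := by
    by_contra h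
    push Not at h
    exact hz (hS z (by omega) (by omega))
  refine integral_eq_zero_of_momentumReversalOn_odd (hμ.map_momentumReversalOn {z, z + 1}) fun σ => ?_
  have hbox : boxRestrictAt a n (momentumReversalOn {z, z + 1} σ) = boxRestrictAt a n σ := by
    funext i
    rw [boxRestrictAt_apply, boxRestrictAt_apply]
    refine momentumReversalOn_apply_not_mem σ ?_
    have hi : (i : ℕ) < n + 1 := i.isLt
    simp only [Finset.mem_insert, Finset.mem_singleton, not_or]
    constructor <;> omega
  rw [hbox, P.bondCurrentZ_momentumReversalOn_of_mem σ (by simp) (by simp)]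
  ring

/-- **Shift invariance of the static current functional**: `Σ'_z ∫ (f ∘ shift) j_z dμ = Σ'_z ∫ f j_z dμ` for every observable `f`
and every shift-invariant `μ` (substitute `σ ↦ τ₁ σ` and re-index the bonds). [folklore] -/
theorem tsum_integral_comp_shift_mul_bondCurrentZ (P : OscillatorChain) {μ : Measure ChainConfig}
    (hS : IsShiftInvariant μ) (f : ChainConfig → ℝ) :
    ∑' z : ℤ, ∫ σ, f (shift σ) * P.bondCurrentZ σ z ∂μ = ∑' z : ℤ, ∫ σ, f σ * P.bondCurrentZ σ z ∂μ := by
  have hterm : ∀ z : ℤ, ∫ σ, f (shift σ) * P.bondCurrentZ σ z ∂μ = ∫ σ, f σ * P.bondCurrentZ σ (z - 1) ∂μ := by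
    intro z
    have h := integral_comp_chainShift_of_isShiftInvariant hS 1 (fun σ => f σ * P.bondCurrentZ σ (z - 1))
    rw [← h]
    refine integral_congr_ae (Eventually.of_forall fun σ => ?_)
    have h1 : (chainShift 1 : ChainConfig → ChainConfig) σ = shift σ := congrFun chainShift_one σ
    have h2 : P.bondCurrentZ (chainShift 1 σ) (z - 1) = P.bondCurrentZ σ z := by
      rw [P.bondCurrentZ_chainShift, sub_add_cancel]
    show f (shift σ) * P.bondCurrentZ σ z = f (chainShift 1 σ) * P.bondCurrentZ (chainShift 1 σ) (z - 1)
    rw [h2, h1]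
  simp_rw [hterm]
  exact (Equiv.subRight (1 : ℤ)).tsum_eq (fun z => ∫ σ, f σ * P.bondCurrentZ σ z ∂μ)

/-- **Oddness of the static current functional**: `Σ'_z ∫ (f ∘ R) j_z dμ = -Σ'_z ∫ f j_z dμ` for every observable `f` and every
`μ` invariant under the momentum reversal `R` (`j_z ∘ R = -j_z`). [folklore] -/
theorem tsum_integral_comp_momentumReversalZ_mul_bondCurrentZ (P : OscillatorChain) {μ : Measure ChainConfig}
    (hR : μ.map momentumReversalZ = μ) (f : ChainConfig → ℝ) :
    ∑' z : ℤ, ∫ σ, f (momentumReversalZ σ) * P.bondCurrentZ σ z ∂μ =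
      -∑' z : ℤ, ∫ σ, f σ * P.bondCurrentZ σ z ∂μ := by
  rw [← tsum_neg]
  refine tsum_congr fun z => ?_
  have h := integral_map_equiv momentumReversalZ (fun σ => f σ * P.bondCurrentZ (momentumReversalZ σ) z) (μ := μ)
  rw [hR] at h
  have hRR : ∀ σ : ChainConfig, momentumReversalZ (momentumReversalZ σ) = σ := fun σ =>
    momentumReversalZ.symm_apply_apply σ
  simp only [hRR] at h
  rw [← h, ← integral_neg]
  refine integral_congr_ae (Eventually.of_forall fun σ => ?_)
  simp only [bondCurrentZ_momentumReversalZ]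
  ring

/-! ## Linearity, unit current and `√n`-regularity of the static current functional (any chain, `L²` hypotheses) -/

section General

variable {P : OscillatorChain}

/-- The second moment of the bond current does not depend on the bond (shift invariance). [folklore] -/
theorem integral_bondCurrentZ_sq_eq_zero_bond (P : OscillatorChain) {μ : Measure ChainConfig} (hS : IsShiftInvariant μ)
    (z : ℤ) : ∫ σ, P.bondCurrentZ σ z ^ 2 ∂μ = ∫ σ, P.bondCurrentZ σ 0 ^ 2 ∂μ := by
  have h := integral_comp_chainShift_of_isShiftInvariant hS z (fun σ => P.bondCurrentZ σ 0 ^ 2)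
  rw [← h]
  refine integral_congr_ae (Eventually.of_forall fun σ => ?_)
  simp only [OscillatorChain.bondCurrentZ_chainShift, zero_add]

/-- **Linearity on cylinder pairs**: `Σ'_z ∫ ((c₁ g₁ + c₂ g₂) ∘ box) j_z = c₁ Σ'_z ∫ (g₁ ∘ box) j_z + c₂ Σ'_z ∫ (g₂ ∘ box) j_z`
(all three series are finite sums over the bonds near the box), given integrability of the products. [folklore] -/
theorem tsum_integral_window_mul_bondCurrentZ_linear {T : ℝ} {μ : Measure ChainConfig}
    (hμ : P.IsChainGibbsMeasure T μ) (a : ℤ) (n : ℕ) (c₁ c₂ : ℝ) (g₁ g₂ : (Fin (n + 1) → ℝ × ℝ) → ℝ)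
    (h1 : ∀ z : ℤ, Integrable (fun σ => g₁ (boxRestrictAt a n σ) * P.bondCurrentZ σ z) μ)
    (h2 : ∀ z : ℤ, Integrable (fun σ => g₂ (boxRestrictAt a n σ) * P.bondCurrentZ σ z) μ) :
    ∑' z : ℤ, ∫ σ, (fun y => c₁ * g₁ y + c₂ * g₂ y) (boxRestrictAt a n σ) * P.bondCurrentZ σ z ∂μ =
      c₁ * ∑' z : ℤ, ∫ σ, g₁ (boxRestrictAt a n σ) * P.bondCurrentZ σ z ∂μ +
        c₂ * ∑' z : ℤ, ∫ σ, g₂ (boxRestrictAt a n σ) * P.bondCurrentZ σ z ∂μ := by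
  set S : Finset ℤ := Finset.Icc (a - 1) (a + n) with hSdef
  have hmem : ∀ z : ℤ, a - 1 ≤ z → z ≤ a + n → z ∈ S := fun z h1 h2 => Finset.mem_Icc.2 ⟨h1, h2⟩
  rw [tsum_integral_window_mul_bondCurrentZ_eq_sum hμ a n (fun y => c₁ * g₁ y + c₂ * g₂ y) hmem,
    tsum_integral_window_mul_bondCurrentZ_eq_sum hμ a n g₁ hmem,
    tsum_integral_window_mul_bondCurrentZ_eq_sum hμ a n g₂ hmem, Finset.mul_sum, Finset.mul_sum,
    ← Finset.sum_add_distrib]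
  refine Finset.sum_congr rfl fun z _ => ?_
  have e : ∀ σ : ChainConfig, (fun y => c₁ * g₁ y + c₂ * g₂ y) (boxRestrictAt a n σ) * P.bondCurrentZ σ z =
      c₁ * (g₁ (boxRestrictAt a n σ) * P.bondCurrentZ σ z) + c₂ * (g₂ (boxRestrictAt a n σ) * P.bondCurrentZ σ z) :=
    fun σ => by simp only; ring
  simp_rw [e]
  rw [integral_add ((h1 z).const_mul c₁) ((h2 z).const_mul c₂), integral_const_mul, integral_const_mul]

/-- **Unit current on every bond**: `Σ'_z ∫ j_i j_z dμ = ∫ j_0² dμ + 2 ∫ j_0 j_1 dμ` for every bond `i` (shift invariance;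
the static covariances are supported in `{i-1, i, i+1}`). [folklore] -/
theorem tsum_integral_bondCurrentZ_mul_bondCurrentZ_eq {T : ℝ} {μ : Measure ChainConfig}
    (hμ : P.IsChainGibbsMeasure T μ) (hS : IsShiftInvariant μ) (i : ℤ) :
    ∑' z : ℤ, ∫ σ, P.bondCurrentZ σ i * P.bondCurrentZ σ z ∂μ =
      (∫ σ, P.bondCurrentZ σ 0 ^ 2 ∂μ) + 2 * ∫ σ, P.bondCurrentZ σ 0 * P.bondCurrentZ σ 1 ∂μ := by
  -- move the bond `i` to `0`
  have hterm : ∀ z : ℤ, ∫ σ, P.bondCurrentZ σ i * P.bondCurrentZ σ z ∂μ =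
      ∫ σ, P.bondCurrentZ σ 0 * P.bondCurrentZ σ (z - i) ∂μ := by
    intro z
    have h := integral_comp_chainShift_of_isShiftInvariant hS i
      (fun σ => P.bondCurrentZ σ 0 * P.bondCurrentZ σ (z - i))
    rw [← h]
    refine integral_congr_ae (Eventually.of_forall fun σ => ?_)
    simp only [OscillatorChain.bondCurrentZ_chainShift, zero_add, sub_add_cancel]
  simp_rw [hterm]
  have e : (∑' z : ℤ, ∫ σ, P.bondCurrentZ σ 0 * P.bondCurrentZ σ (z - i) ∂μ) =
      ∑' x : ℤ, ∫ σ, P.bondCurrentZ σ 0 * P.bondCurrentZ σ x ∂μ :=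
    (Equiv.subRight i).tsum_eq (fun x => ∫ σ, P.bondCurrentZ σ 0 * P.bondCurrentZ σ x ∂μ)
  rw [e, hμ.tsum_integral_bondCurrentZ_mul]
  -- `∫ j_0 j_{-1} = ∫ j_1 j_0 = ∫ j_0 j_1`
  have hm1 : ∫ σ, P.bondCurrentZ σ 0 * P.bondCurrentZ σ (-1) ∂μ = ∫ σ, P.bondCurrentZ σ 0 * P.bondCurrentZ σ 1 ∂μ := by
    have h := integral_comp_chainShift_of_isShiftInvariant hS 1
      (fun σ => P.bondCurrentZ σ 0 * P.bondCurrentZ σ (-1))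
    rw [← h]
    refine integral_congr_ae (Eventually.of_forall fun σ => ?_)
    simp only [OscillatorChain.bondCurrentZ_chainShift, zero_add]
    norm_num
    ring
  rw [hm1]
  simp only [pow_two]
  ring

/-- At most three bonds are within distance one of a given bond. [folklore] -/
theorem card_filter_abs_sub_lt_two_le : ∀ (S : Finset ℤ) (z : ℤ), (S.filter fun w : ℤ => ¬ (2 ≤ |w - z|)).card ≤ 3 := by
  intro S z
  calc (S.filter fun w : ℤ => ¬ (2 ≤ |w - z|)).card ≤ ({z - 1, z, z + 1} : Finset ℤ).card := by
        refine Finset.card_le_card fun w hw => ?_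
        rw [Finset.mem_filter] at hw
        have h := hw.2
        rw [not_le, abs_lt] at h
        simp only [Finset.mem_insert, Finset.mem_singleton]
        omega
    _ ≤ 3 := Finset.card_le_three

/-- **`√n`-regularity of the static current functional**: for a continuous window profile `g` of polynomial growth on
`{a, …, a+n}`, `|Σ'_z ∫ g(box) j_z dμ| ≤ √(6 ∫ j_0² dμ) · √(n+1) · ‖g ∘ box‖_{L²(μ)}` — Cauchy–Schwarz against `J = Σ_{z=a-1}^{a+n} j_z`,
whose square norm is at most `3 (n+2) ∫ j_0²` because `j_z ⊥ j_w` for `|z - w| ≥ 2`; square integrability of the currents and of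
the window observable are hypotheses (for the pinned chain: superstability). [folklore] -/
theorem abs_tsum_integral_window_mul_bondCurrentZ_le {T : ℝ} {μ : Measure ChainConfig}
    (hμ : P.IsChainGibbsMeasure T μ) (hS : IsShiftInvariant μ)
    (hj2 : ∀ z : ℤ, MemLp (fun σ => P.bondCurrentZ σ z) 2 μ) (a : ℤ) (n : ℕ)
    (g : (Fin (n + 1) → ℝ × ℝ) → ℝ) (hg2 : MemLp (fun σ => g (boxRestrictAt a n σ)) 2 μ) :
    |∑' z : ℤ, ∫ σ, g (boxRestrictAt a n σ) * P.bondCurrentZ σ z ∂μ| ≤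
      Real.sqrt (6 * ∫ σ, P.bondCurrentZ σ 0 ^ 2 ∂μ) * Real.sqrt ((n : ℝ) + 1) *
        Real.sqrt (∫ σ, (g (boxRestrictAt a n σ)) ^ 2 ∂μ) := by
  haveI : IsProbabilityMeasure μ := hμ.isProbabilityMeasure
  set V₀ : ℝ := ∫ σ, P.bondCurrentZ σ 0 ^ 2 ∂μ with hV₀
  set S : Finset ℤ := Finset.Icc (a - 1) (a + n) with hSdef
  have hmem : ∀ z : ℤ, a - 1 ≤ z → z ≤ a + n → z ∈ S := fun z h1 h2 => Finset.mem_Icc.2 ⟨h1, h2⟩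
  have hcard : S.card = n + 2 := by
    rw [hSdef, Int.card_Icc]
    have : a + (n : ℤ) + 1 - (a - 1) = ((n + 2 : ℕ) : ℤ) := by push_cast; ring
    rw [this, Int.toNat_natCast]
  set J : ChainConfig → ℝ := fun σ => ∑ z ∈ S, P.bondCurrentZ σ z with hJ
  have hJ2 : MemLp J 2 μ := memLp_finsetSum S fun z _ => hj2 z
  have hjj : ∀ z w : ℤ, Integrable (fun σ => P.bondCurrentZ σ z * P.bondCurrentZ σ w) μ := fun z w =>
    (hj2 z).integrable_mul (hj2 w)
  -- the functional as one integral against `J`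
  have hsum : ∑' z : ℤ, ∫ σ, g (boxRestrictAt a n σ) * P.bondCurrentZ σ z ∂μ =
      ∫ σ, g (boxRestrictAt a n σ) * J σ ∂μ := by
    have hint : ∀ z : ℤ, Integrable (fun σ => g (boxRestrictAt a n σ) * P.bondCurrentZ σ z) μ := fun z =>
      hg2.integrable_mul (hj2 z)
    rw [tsum_integral_window_mul_bondCurrentZ_eq_sum hμ a n g hmem, ← integral_finsetSum S fun z _ => hint z]
    refine integral_congr_ae (Eventually.of_forall fun σ => ?_)
    simp only [hJ, Finset.mul_sum]
  -- `∫ J² ≤ 3 (n+2) V₀`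
  have hV₀z : ∀ z : ℤ, ∫ σ, P.bondCurrentZ σ z ^ 2 ∂μ = V₀ := fun z =>
    integral_bondCurrentZ_sq_eq_zero_bond P hS z
  have hpair : ∀ z w : ℤ, |∫ σ, P.bondCurrentZ σ z * P.bondCurrentZ σ w ∂μ| ≤
      if 2 ≤ |w - z| then 0 else V₀ := by
    intro z w
    split_ifs with h
    · rw [hμ.integral_bondCurrentZ_mul_eq_zero h, abs_zero]
    · calc |∫ σ, P.bondCurrentZ σ z * P.bondCurrentZ σ w ∂μ|
          ≤ ∫ σ, |P.bondCurrentZ σ z * P.bondCurrentZ σ w| ∂μ := abs_integral_le_integral_abs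
        _ ≤ ∫ σ, (P.bondCurrentZ σ z ^ 2 + P.bondCurrentZ σ w ^ 2) / 2 ∂μ := by
            refine integral_mono (hjj z w).abs
              (((hj2 z).integrable_sq.add (hj2 w).integrable_sq).div_const 2) fun σ => ?_
            rw [abs_mul]
            nlinarith [sq_nonneg (|P.bondCurrentZ σ z| - |P.bondCurrentZ σ w|), sq_abs (P.bondCurrentZ σ z),
              sq_abs (P.bondCurrentZ σ w)]
        _ = V₀ := by
            rw [integral_div, integral_add (hj2 z).integrable_sq (hj2 w).integrable_sq, hV₀z z, hV₀z w]
            ring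
  have hJsq : ∫ σ, J σ ^ 2 ∂μ ≤ 3 * ((n : ℝ) + 2) * V₀ := by
    have hexp : ∀ σ, J σ ^ 2 = ∑ z ∈ S, ∑ w ∈ S, P.bondCurrentZ σ z * P.bondCurrentZ σ w := fun σ => by
      rw [hJ, pow_two, Finset.sum_mul_sum]
    simp_rw [hexp]
    have hrow : ∀ z : ℤ, Integrable (fun σ => ∑ w ∈ S, P.bondCurrentZ σ z * P.bondCurrentZ σ w) μ := fun z =>
      integrable_finsetSum S fun w _ => hjj z w
    rw [integral_finsetSum S fun z _ => hrow z]
    calc ∑ z ∈ S, ∫ σ, ∑ w ∈ S, P.bondCurrentZ σ z * P.bondCurrentZ σ w ∂μ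
        = ∑ z ∈ S, ∑ w ∈ S, ∫ σ, P.bondCurrentZ σ z * P.bondCurrentZ σ w ∂μ := by
          refine Finset.sum_congr rfl fun z _ => ?_
          exact integral_finsetSum S fun w _ => hjj z w
      _ ≤ ∑ z ∈ S, ∑ w ∈ S, |∫ σ, P.bondCurrentZ σ z * P.bondCurrentZ σ w ∂μ| :=
          Finset.sum_le_sum fun z _ => Finset.sum_le_sum fun w _ => le_abs_self _
      _ ≤ ∑ z ∈ S, ∑ w ∈ S, (if 2 ≤ |w - z| then 0 else V₀) :=
          Finset.sum_le_sum fun z _ => Finset.sum_le_sum fun w _ => hpair z w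
      _ ≤ ∑ _z ∈ S, 3 * V₀ := by
          refine Finset.sum_le_sum fun z _ => ?_
          rw [← Finset.sum_filter_add_sum_filter_not S (fun w : ℤ => 2 ≤ |w - z|)]
          rw [Finset.sum_ite_of_true (fun w hw => (Finset.mem_filter.1 hw).2),
            Finset.sum_ite_of_false (fun w hw => (Finset.mem_filter.1 hw).2), Finset.sum_const_zero, zero_add,
            Finset.sum_const, nsmul_eq_mul]
          have hV0 : 0 ≤ V₀ := integral_nonneg fun σ => sq_nonneg _
          have hc : ((S.filter fun w : ℤ => ¬ (2 ≤ |w - z|)).card : ℝ) ≤ 3 := by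
            exact_mod_cast card_filter_abs_sub_lt_two_le S z
          nlinarith
      _ = 3 * ((n : ℝ) + 2) * V₀ := by
          rw [Finset.sum_const, hcard, nsmul_eq_mul]; push_cast; ring
  -- Cauchy–Schwarz
  have hCS := abs_integral_mul_le_sqrt_integral_sq_mul hg2 hJ2
  have hV0 : 0 ≤ V₀ := integral_nonneg fun σ => sq_nonneg _
  have hJsqrt : Real.sqrt (∫ σ, J σ ^ 2 ∂μ) ≤ Real.sqrt (6 * V₀) * Real.sqrt ((n : ℝ) + 1) := by
    rw [← Real.sqrt_mul (by positivity)]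
    refine Real.sqrt_le_sqrt (hJsq.trans ?_)
    have hn : (0 : ℝ) ≤ n := Nat.cast_nonneg n
    nlinarith
  rw [hsum]
  calc |∫ σ, g (boxRestrictAt a n σ) * J σ ∂μ|
      ≤ Real.sqrt (∫ σ, g (boxRestrictAt a n σ) ^ 2 ∂μ) * Real.sqrt (∫ σ, J σ ^ 2 ∂μ) := hCS
    _ ≤ Real.sqrt (∫ σ, g (boxRestrictAt a n σ) ^ 2 ∂μ) * (Real.sqrt (6 * V₀) * Real.sqrt ((n : ℝ) + 1)) :=
        mul_le_mul_of_nonneg_left hJsqrt (Real.sqrt_nonneg _)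
    _ = Real.sqrt (6 * V₀) * Real.sqrt ((n : ℝ) + 1) * Real.sqrt (∫ σ, g (boxRestrictAt a n σ) ^ 2 ∂μ) := by ring

end General

end Summit.AtomisticToContinuum.FouriersLaw.Theorems.LocalOhmBirth

end
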